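import Mathlib
import Literature.Analysis.FluidPDE.VectorCalculus
import Summits.NavierStokesRegularity.NavierStokesRegularity.Theorems.ThreadingFluxErtelTowerAlgebra
import HarnessLib

/-!
# Crux `PoloidalLiouville` (stmt-NavierStokesRegularity-1222, W1), crux idea «radial-jerk-tower» (ns-idea-15 g7):
# INVISCID STRAIN RIGIDITY — no frozen sphere-tangent field near a triaxial strain centre

Support file (`--supports stmt-NavierStokesRegularity-1222`, helper; critic V21-P3: «`InviscidStrainRigidity` as the first
Prop closed BY NAME»).  Experiment cell `ns-wall-extremal`, width hand ns-wall-eng-5 g6, director KEY-NS #186.  0 kit.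

* `ErtelTower.ertel_step` — ONE LEVEL OF THE INVISCID STRAIN TOWER: for `B` jointly smooth and frozen into the drift `Sx` on
  an open `I × U` (`∂ₜB + DB[Sx] − SB = 0`), an identity `⟪B, Mx⟫ ≡ 0` with `M` a diagonal (hence symmetric, commuting with
  `S`) matrix propagates to `⟪B, MSx⟫ ≡ 0` (differentiate in `t` and along `Sx`, insert the frozen equation, use the
  symmetry `⟪SB, Mx⟫ = ⟪B, SMx⟫`) — Ertel's commutation in its simplest instance, no flow map needed;
* `ErtelTower.inviscidStrainRigidity : InviscidStrainRigidity` — **the sketch Prop (`ErtelTowerSketch.lean` l.454, twin in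
  `ThreadingFluxErtelTowerDefs`) is a theorem**: tangency `⟪B,x⟫ ≡ 0` ⇒ `⟪B,Sx⟫ ≡ 0` ⇒ `⟪B,S²x⟫ ≡ 0` (two Ertel steps),
  `strainTower_closure` (Vandermonde) kills `B` off the principal planes, and continuity of `B(t,·)` on the open `U` (where
  the complement of the three planes is dense) finishes.  Neither incompressibility nor `div B = 0` is used.

HONEST FRAME (critic V21-P4): a statement about the FROZEN-FIELD (inviscid, linearised) equation in the background `Sx` — the
kinematics of the linearisation at a triaxial strain centre — not about ⟨27585⟩ `UnthreadedRigidity` or ⟨1222⟩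
`PoloidalLiouville`, which are OPEN; NS regularity is NOT proved.
-/

-- the summit and its single problem share the name (D-0017 nested layout)
set_option linter.dupNamespace false

noncomputable section

namespace Summit.NavierStokesRegularity.NavierStokesRegularity.Theorems.PoloidalLiouville.ErtelTower

open Set Function Filter Topology Metric
open scoped Topology RealInnerProductSpace InnerProductSpace
open Summit.NavierStokesRegularity.NavierStokesRegularity.Theorems.PoloidalLiouville.HorizonTower (E3)

/-! ### Linear-algebra facts about the diagonal strain -/

/-- The diagonal strain is symmetric: `⟪S v, w⟫ = ⟪v, S w⟫`. -/
theorem inner_strain_comm (a b c : ℝ) (v w : E3) :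
    inner ℝ (strain a b c v) w = inner ℝ v (strain a b c w) := by
  simp [strain, EuclideanSpace.inner_eq_star_dotProduct, dotProduct, Fin.sum_univ_three]
  ring

/-- `S(Sx) = S²x` (the strain with squared rates). -/
theorem strain_strain (a b c : ℝ) (x : E3) :
    strain a b c (strain a b c x) = strain (a ^ 2) (b ^ 2) (c ^ 2) x := by
  ext i
  fin_cases i <;> simp [strain] <;> ring

/-- The strain drift is linear: it is (the coercion of) a continuous linear map, hence its own derivative. -/
theorem hasFDerivAt_strain (a b c : ℝ) (x : E3) :
    ∃ L : E3 →L[ℝ] E3, (∀ v, L v = strain a b c v) ∧ HasFDerivAt (strain a b c) L x := by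
  have hlin : IsLinearMap ℝ (strain a b c) := by
    refine ⟨fun v w => ?_, fun r v => ?_⟩
    · ext i; fin_cases i <;> simp [strain] <;> ring
    · ext i; fin_cases i <;> simp [strain] <;> ring
  let L : E3 →L[ℝ] E3 := LinearMap.toContinuousLinearMap (hlin.mk' _)
  have hL : ∀ v, L v = strain a b c v := fun v => rfl
  refine ⟨L, hL, ?_⟩
  have h := L.hasFDerivAt (x := x)
  have hcoe : (L : E3 → E3) = strain a b c := funext hL
  rwa [hcoe] at h

/-! ### Partial derivatives of a jointly smooth field -/

section Partial

variable {B : ℝ → E3 → E3} {I : Set ℝ} {U : Set E3} {t : ℝ} {x : E3}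

/-- Time slices of a jointly smooth field are differentiable in `t`. -/
theorem differentiableAt_time (hB : ContDiffOn ℝ (⊤ : ℕ∞) (Function.uncurry B) (I ×ˢ U))
    (hI : IsOpen I) (hU : IsOpen U) (ht : t ∈ I) (hx : x ∈ U) :
    DifferentiableAt ℝ (fun s => B s x) t := by
  have h1 : ContDiffAt ℝ (⊤ : ℕ∞) (Function.uncurry B) (t, x) :=
    hB.contDiffAt ((hI.prod hU).mem_nhds ⟨ht, hx⟩)
  have h2 : DifferentiableAt ℝ (Function.uncurry B) (t, x) := h1.differentiableAt (by simp)
  have h3 : DifferentiableAt ℝ (fun s : ℝ => (s, x)) t := differentiableAt_id.prodMk (differentiableAt_const x)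
  exact h2.comp t h3

/-- Space slices of a jointly smooth field are differentiable in `x`. -/
theorem differentiableAt_space (hB : ContDiffOn ℝ (⊤ : ℕ∞) (Function.uncurry B) (I ×ˢ U))
    (hI : IsOpen I) (hU : IsOpen U) (ht : t ∈ I) (hx : x ∈ U) :
    DifferentiableAt ℝ (B t) x := by
  have h1 : ContDiffAt ℝ (⊤ : ℕ∞) (Function.uncurry B) (t, x) :=
    hB.contDiffAt ((hI.prod hU).mem_nhds ⟨ht, hx⟩)
  have h2 : DifferentiableAt ℝ (Function.uncurry B) (t, x) := h1.differentiableAt (by simp)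
  have h3 : DifferentiableAt ℝ (fun z : E3 => (t, z)) x := (differentiableAt_const t).prodMk differentiableAt_id
  exact h2.comp x h3

/-- Space slices of a jointly smooth field are continuous on `U`. -/
theorem continuousOn_space (hB : ContDiffOn ℝ (⊤ : ℕ∞) (Function.uncurry B) (I ×ˢ U))
    (hI : IsOpen I) (hU : IsOpen U) (ht : t ∈ I) : ContinuousOn (B t) U :=
  fun _ hz => (differentiableAt_space hB hI hU ht hz).continuousAt.continuousWithinAt

end Partial

/-! ### One level of the inviscid strain tower -/

/-- **One Ertel step in a linear strain.**  If `B` is frozen into the drift `Sx` on the open set `I × U`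
(`∂ₜB + DB[Sx] − SB = 0`) and `⟪B, Mx⟫ ≡ 0` there for a symmetric matrix `M` commuting with `S` — here `M = S^j`,
encoded as the diagonal strain with rates `(α, β, γ)` — then `⟪B, M S x⟫ ≡ 0` there as well.  (Differentiate the
identity in `t` and along `Sx`, insert the frozen equation, and use the symmetry `⟪SB, Mx⟫ = ⟪B, SMx⟫`.) -/
theorem ertel_step {a b c α β γ : ℝ} {B : ℝ → E3 → E3} {I : Set ℝ} {U : Set E3} (hI : IsOpen I) (hU : IsOpen U)
    (hB : ContDiffOn ℝ (⊤ : ℕ∞) (Function.uncurry B) (I ×ˢ U))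
    (hfrozen : ∀ t ∈ I, ∀ x ∈ U,
      deriv (fun s => B s x) t + fderiv ℝ (B t) x (strain a b c x) - strain a b c (B t x) = 0)
    (hlevel : ∀ t ∈ I, ∀ x ∈ U, inner ℝ (B t x) (strain α β γ x) = 0) :
    ∀ t ∈ I, ∀ x ∈ U, inner ℝ (B t x) (strain (α * a) (β * b) (γ * c) x) = 0 := by
  intro t ht x hx
  obtain ⟨M, hM, hMd⟩ := hasFDerivAt_strain α β γ x
  have hBt := differentiableAt_time hB hI hU ht hx
  have hBx := differentiableAt_space hB hI hU ht hx
  -- (1) the time derivative of `s ↦ ⟪B s x, Mx⟫ ≡ 0` vanishes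
  have hzero_t : deriv (fun s => inner ℝ (B s x) (strain α β γ x)) t = 0 := by
    have hev : (fun s => inner ℝ (B s x) (strain α β γ x)) =ᶠ[𝓝 t] fun _ => (0 : ℝ) := by
      filter_upwards [hI.mem_nhds ht] with s hs using hlevel s hs x hx
    rw [hev.deriv_eq, deriv_const]
  have hderiv_t : deriv (fun s => inner ℝ (B s x) (strain α β γ x)) t
      = inner ℝ (deriv (fun s => B s x) t) (strain α β γ x) := by
    have h := (HasDerivAt.inner ℝ hBt.hasDerivAt (hasDerivAt_const t (strain α β γ x))).deriv
    rw [h, inner_zero_right, zero_add]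
  -- (2) the space derivative of `z ↦ ⟪B t z, Mz⟫ ≡ 0` along `Sx` vanishes
  have hzero_x : fderiv ℝ (fun z => inner ℝ (B t z) (strain α β γ z)) x (strain a b c x) = 0 := by
    have hev : (fun z => inner ℝ (B t z) (strain α β γ z)) =ᶠ[𝓝 x] fun _ => (0 : ℝ) := by
      filter_upwards [hU.mem_nhds hx] with z hz using hlevel t ht z hz
    rw [hev.fderiv_eq]
    simp
  have hderiv_x : fderiv ℝ (fun z => inner ℝ (B t z) (strain α β γ z)) x (strain a b c x)
      = inner ℝ (fderiv ℝ (B t) x (strain a b c x)) (strain α β γ x)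
        + inner ℝ (B t x) (strain α β γ (strain a b c x)) := by
    have h := (HasFDerivAt.inner ℝ hBx.hasFDerivAt hMd).fderiv
    rw [h]
    simp only [ContinuousLinearMap.comp_apply, ContinuousLinearMap.prod_apply, fderivInnerCLM_apply, hM]
    rw [add_comm]
  -- (3) insert the frozen equation `∂ₜB = −DB[Sx] + SB`
  have hfr : deriv (fun s => B s x) t = -(fderiv ℝ (B t) x (strain a b c x)) + strain a b c (B t x) := by
    have h := hfrozen t ht x hx
    rw [sub_eq_zero] at h
    rw [← h]; abel
  have e1 : inner ℝ (-(fderiv ℝ (B t) x (strain a b c x)) + strain a b c (B t x)) (strain α β γ x) = 0 := by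
    rw [← hfr, ← hderiv_t, hzero_t]
  have e2 : inner ℝ (fderiv ℝ (B t) x (strain a b c x)) (strain α β γ x)
      + inner ℝ (B t x) (strain α β γ (strain a b c x)) = 0 := by
    rw [← hderiv_x, hzero_x]
  -- (4) add: `⟪SB, Mx⟫ + ⟪B, M(Sx)⟫ = 0`, and `⟪SB, Mx⟫ = ⟪B, S(Mx)⟫ = ⟪B, M(Sx)⟫`
  have hsym : inner ℝ (strain a b c (B t x)) (strain α β γ x) = inner ℝ (B t x) (strain α β γ (strain a b c x)) := by
    rw [inner_strain_comm]
    congr 1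
    ext i; fin_cases i <;> simp [strain] <;> ring
  have hMS : strain α β γ (strain a b c x) = strain (α * a) (β * b) (γ * c) x := by
    ext i; fin_cases i <;> simp [strain] <;> ring
  rw [inner_add_left, inner_neg_left, hsym] at e1
  rw [← hMS]
  linarith

/-! ### The theorem -/

/-- **INVISCID STRAIN RIGIDITY** (`ErtelTowerSketch.lean` Prop `InviscidStrainRigidity`, closed BY NAME over the twin):
no non-zero field frozen into a TRIAXIAL linear strain stays tangent to the spheres about its centre on any open space-time
set.  Proof: levels 1 and 2 of the inviscid strain tower by `ertel_step` (`⟪B,x⟫ ≡ 0 ⇒ ⟪B,Sx⟫ ≡ 0 ⇒ ⟪B,S²x⟫ ≡ 0`), the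
Vandermonde closure `strainTower_closure` off the principal planes, and continuity of `B(t,·)` on the open `U`, in which
the complement of the three principal planes is dense. -/
theorem inviscidStrainRigidity : InviscidStrainRigidity := by
  intro a b c B I U hab hbc hca hI hU hB hfrozen htan t ht x hx
  -- level 0 as `strain 1 1 1`
  have h0 : ∀ s ∈ I, ∀ z ∈ U, inner ℝ (B s z) (strain 1 1 1 z) = 0 := by
    intro s hs z hz
    have : strain 1 1 1 z = z := by ext i; fin_cases i <;> simp [strain]
    rw [this]; exact htan s hs z hz
  -- levels 1 and 2
  have h1 := ertel_step hI hU hB hfrozen h0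
  simp only [one_mul] at h1
  have h2 := ertel_step hI hU hB hfrozen h1
  have h2' : ∀ s ∈ I, ∀ z ∈ U, inner ℝ (B s z) (strain (a ^ 2) (b ^ 2) (c ^ 2) z) = 0 := by
    intro s hs z hz; have := h2 s hs z hz; simpa [sq] using this
  -- off the principal planes `B` vanishes
  have hoff : ∀ z ∈ U, z 0 ≠ 0 → z 1 ≠ 0 → z 2 ≠ 0 → B t z = 0 := fun z hz h0z h1z h2z =>
    strainTower_closure a b c z (B t z) hab hbc hca h0z h1z h2z (htan t ht z hz) (h1 t ht z hz) (h2' t ht z hz)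
  -- density + continuity
  set G : Set E3 := U ∩ {z | z 0 ≠ 0 ∧ z 1 ≠ 0 ∧ z 2 ≠ 0} with hG
  have hxcl : x ∈ closure G := by
    -- the probe curve `ε ↦ x + ε·(1,1,1)`, `ε → 0⁺`
    set w : E3 := WithLp.toLp 2 (fun _ : Fin 3 => (1 : ℝ)) with hw
    have hwi : ∀ i : Fin 3, w i = 1 := fun i => rfl
    have hγ : Tendsto (fun ε : ℝ => x + ε • w) (𝓝[>] 0) (𝓝 x) := by
      have : Tendsto (fun ε : ℝ => x + ε • w) (𝓝 0) (𝓝 (x + (0 : ℝ) • w)) :=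
        tendsto_const_nhds.add (tendsto_id.smul tendsto_const_nhds)
      rw [zero_smul, add_zero] at this
      exact this.mono_left nhdsWithin_le_nhds
    refine mem_closure_of_tendsto hγ ?_
    have hU' : ∀ᶠ ε : ℝ in 𝓝[>] 0, x + ε • w ∈ U := hγ (hU.mem_nhds hx)
    have hcoord : ∀ i : Fin 3, ∀ᶠ ε : ℝ in 𝓝[>] 0, (x + ε • w) i ≠ 0 := by
      intro i
      have happ : ∀ ε : ℝ, (x + ε • w) i = x i + ε := by
        intro ε; simp [hwi]
      by_cases hxi : 0 ≤ x i
      · filter_upwards [self_mem_nhdsWithin] with ε hε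
        rw [happ]; rw [mem_Ioi] at hε; linarith
      · push Not at hxi
        filter_upwards [Ioo_mem_nhdsGT (neg_pos.mpr hxi)] with ε hε
        rw [happ]; rw [mem_Ioo] at hε; linarith
    filter_upwards [hU', hcoord 0, hcoord 1, hcoord 2] with ε hεU h0ε h1ε h2ε
    exact ⟨hεU, h0ε, h1ε, h2ε⟩
  have hcont : ContinuousWithinAt (B t) G x :=
    ((continuousOn_space hB hI hU ht).continuousWithinAt hx).mono inter_subset_left
  have hzero : (B t) =ᶠ[𝓝[G] x] fun _ => (0 : E3) := by
    filter_upwards [self_mem_nhdsWithin] with z hz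
    exact hoff z hz.1 hz.2.1 hz.2.2.1 hz.2.2.2
  haveI : (𝓝[G] x).NeBot := mem_closure_iff_nhdsWithin_neBot.mp hxcl
  exact tendsto_nhds_unique hcont.tendsto (tendsto_const_nhds.congr' hzero.symm)


end Summit.NavierStokesRegularity.NavierStokesRegularity.Theorems.PoloidalLiouville.ErtelTower
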